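import Mathlib
import HarnessLib

/-!
# The ring `ℤ[∛2]`, its norm, its real embedding, and its units `±(∛2 - 1)ⁿ`

Infrastructure for Euler's theorem on `x ² - y ³ = 1` (the case "`p = 2`, `q = 3`" of Catalan's
equation, [Schoof2009, Chapter 4]) in W. McCallum's treatment via the Thue equation
`v ³ - 2 u ³ = 1`, i.e. via units `v - u ∛2` of `ℤ[∛2]` [Schoof2009, Proposition 4.2]. Following the
model of Mathlib's `Zsqrtd`, the ring is realised concretely as triples `⟨a, b, c⟩ = a + b θ + c θ²`
with `θ ³ = 2`:

* `ZCbrt` with its `CommRing` structure, the norm `N(a + bθ + cθ²) = a³ + 2b³ + 4c³ - 6abc`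
  (multiplicative, `norm_mul`), the cofactor `adj` with `x * adj x = N(x)`, the real embedding
  `toReal` (`θ ↦ 2^{1/3}`, a ring homomorphism) with `1.25 < 2^{1/3} < 1.26`;
* the units `η = θ - 1` and `η⁻¹ = 1 + θ + θ²` (`eta_mul_etaInv`);
* **[Schoof2009, Exercise 4.4] — the unit theorem for `ℤ[∛2]`**: `eq_one_of_norm_of_toReal`
  (a norm-`±1` element with real embedding in `(1/2, 1]` is `1`, via the identity
  `3 (a² + b²θ² + 2c²θ) · x' = x'³ + 2 N(x)`), and `exists_eq_eta_pow_of_norm` (every element of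
  norm `±1` is `± ηⁿ` or `± (η⁻¹)ⁿ`, `n : ℕ`).

Everything here is proved; the only definitions are the concrete ring and its structure maps.
-/

namespace Literature.NumberTheory.DiophantineGeometry

/-- The ring `ℤ[∛2]`: triples `⟨a, b, c⟩` standing for `a + b θ + c θ²` with `θ = ∛2`
(so `θ³ = 2`), after the model of Mathlib's `Zsqrtd`. [cite: Schoof2009, Chapter 4 (p. 15)] -/
@[ext]
structure ZCbrt where
  /-- coefficient of `1` -/
  a : ℤ
  /-- coefficient of `θ = ∛2` -/
  b : ℤ
  /-- coefficient of `θ² = ∛4` -/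
  c : ℤ
  deriving DecidableEq

namespace ZCbrt

/-- Zero of `ℤ[∛2]`. [folklore] -/
instance : Zero ZCbrt := ⟨⟨0, 0, 0⟩⟩
/-- One of `ℤ[∛2]`. [folklore] -/
instance : One ZCbrt := ⟨⟨1, 0, 0⟩⟩
/-- Addition of `ℤ[∛2]` (componentwise). [folklore] -/
instance : Add ZCbrt := ⟨fun x y => ⟨x.a + y.a, x.b + y.b, x.c + y.c⟩⟩
/-- Negation of `ℤ[∛2]` (componentwise). [folklore] -/
instance : Neg ZCbrt := ⟨fun x => ⟨-x.a, -x.b, -x.c⟩⟩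
/-- Multiplication `(a + bθ + cθ²)(a' + b'θ + c'θ²)` of `ℤ[∛2]`, using `θ³ = 2`. [folklore] -/
instance : Mul ZCbrt :=
  ⟨fun x y => ⟨x.a * y.a + 2 * x.b * y.c + 2 * x.c * y.b,
    x.a * y.b + x.b * y.a + 2 * x.c * y.c,
    x.a * y.c + x.b * y.b + x.c * y.a⟩⟩

/-- Components of `0`. [folklore] -/
@[simp] theorem zero_a : (0 : ZCbrt).a = 0 := rfl
/-- Components of `0`. [folklore] -/
@[simp] theorem zero_b : (0 : ZCbrt).b = 0 := rfl
/-- Components of `0`. [folklore] -/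
@[simp] theorem zero_c : (0 : ZCbrt).c = 0 := rfl
/-- Components of `1`. [folklore] -/
@[simp] theorem one_a : (1 : ZCbrt).a = 1 := rfl
/-- Components of `1`. [folklore] -/
@[simp] theorem one_b : (1 : ZCbrt).b = 0 := rfl
/-- Components of `1`. [folklore] -/
@[simp] theorem one_c : (1 : ZCbrt).c = 0 := rfl
/-- Components of a sum. [folklore] -/
@[simp] theorem add_a' (x y : ZCbrt) : (x + y).a = x.a + y.a := rfl
/-- Components of a sum. [folklore] -/
@[simp] theorem add_b' (x y : ZCbrt) : (x + y).b = x.b + y.b := rfl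
/-- Components of a sum. [folklore] -/
@[simp] theorem add_c' (x y : ZCbrt) : (x + y).c = x.c + y.c := rfl
/-- Components of a negation. [folklore] -/
@[simp] theorem neg_a' (x : ZCbrt) : (-x).a = -x.a := rfl
/-- Components of a negation. [folklore] -/
@[simp] theorem neg_b' (x : ZCbrt) : (-x).b = -x.b := rfl
/-- Components of a negation. [folklore] -/
@[simp] theorem neg_c' (x : ZCbrt) : (-x).c = -x.c := rfl
/-- Components of a product (`θ³ = 2`). [folklore] -/
@[simp] theorem mul_a' (x y : ZCbrt) : (x * y).a = x.a * y.a + 2 * x.b * y.c + 2 * x.c * y.b := rfl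
/-- Components of a product (`θ³ = 2`). [folklore] -/
@[simp] theorem mul_b' (x y : ZCbrt) : (x * y).b = x.a * y.b + x.b * y.a + 2 * x.c * y.c := rfl
/-- Components of a product (`θ³ = 2`). [folklore] -/
@[simp] theorem mul_c' (x y : ZCbrt) : (x * y).c = x.a * y.c + x.b * y.b + x.c * y.a := rfl

/-- `ℤ[∛2]` is an additive commutative group (componentwise). [folklore] -/
instance addCommGroup : AddCommGroup ZCbrt := by
  refine
  { sub := fun x y => x + -y
    nsmul := @nsmulRec ZCbrt ⟨0⟩ ⟨(· + ·)⟩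
    zsmul := @zsmulRec ZCbrt ⟨0⟩ ⟨(· + ·)⟩ ⟨Neg.neg⟩ (@nsmulRec ZCbrt ⟨0⟩ ⟨(· + ·)⟩)
    add_assoc := ?_
    zero_add := ?_
    add_zero := ?_
    neg_add_cancel := ?_
    add_comm := ?_ } <;>
  intros <;> ext <;> simp <;> ring

/-- Integer and natural casts `n ↦ ⟨n, 0, 0⟩`. [folklore] -/
instance addGroupWithOne : AddGroupWithOne ZCbrt :=
  { ZCbrt.addCommGroup with
    natCast := fun n => ⟨n, 0, 0⟩
    intCast := fun n => ⟨n, 0, 0⟩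
    natCast_zero := by rfl
    natCast_succ := fun n => by ext <;> simp
    intCast_ofNat := fun n => by rfl
    intCast_negSucc := fun n => by
      show (⟨Int.negSucc n, 0, 0⟩ : ZCbrt) = -⟨((n + 1 : ℕ) : ℤ), 0, 0⟩
      ext <;> simp [Int.negSucc_eq] }

/-- `ℤ[∛2]` is a commutative ring (the axioms hold coefficientwise). [folklore] -/
instance commRing : CommRing ZCbrt := by
  refine
  { ZCbrt.addGroupWithOne with
    npow := @npowRec ZCbrt ⟨1⟩ ⟨(· * ·)⟩
    add_comm := add_comm
    left_distrib := ?_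
    right_distrib := ?_
    zero_mul := ?_
    mul_zero := ?_
    mul_assoc := ?_
    one_mul := ?_
    mul_one := ?_
    mul_comm := ?_ } <;>
  intros <;> ext <;> simp <;> ring

/-- Components of a difference. [folklore] -/
@[simp] theorem sub_a' (x y : ZCbrt) : (x - y).a = x.a - y.a := by
  simp [sub_eq_add_neg]
/-- Components of a difference. [folklore] -/
@[simp] theorem sub_b' (x y : ZCbrt) : (x - y).b = x.b - y.b := by
  simp [sub_eq_add_neg]
/-- Components of a difference. [folklore] -/
@[simp] theorem sub_c' (x y : ZCbrt) : (x - y).c = x.c - y.c := by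
  simp [sub_eq_add_neg]
/-- Components of an integer. [folklore] -/
@[simp] theorem intCast_a (n : ℤ) : (n : ZCbrt).a = n := rfl
/-- Components of an integer. [folklore] -/
@[simp] theorem intCast_b (n : ℤ) : (n : ZCbrt).b = 0 := rfl
/-- Components of an integer. [folklore] -/
@[simp] theorem intCast_c (n : ℤ) : (n : ZCbrt).c = 0 := rfl
/-- Components of a natural number. [folklore] -/
@[simp] theorem natCast_a (n : ℕ) : (n : ZCbrt).a = n := rfl
/-- Components of a natural number. [folklore] -/
@[simp] theorem natCast_b (n : ℕ) : (n : ZCbrt).b = 0 := rfl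
/-- Components of a natural number. [folklore] -/
@[simp] theorem natCast_c (n : ℕ) : (n : ZCbrt).c = 0 := rfl
/-- Components of a numeral. [folklore] -/
@[simp] theorem ofNat_a (n : ℕ) [n.AtLeastTwo] : (ofNat(n) : ZCbrt).a = n := rfl
/-- Components of a numeral. [folklore] -/
@[simp] theorem ofNat_b (n : ℕ) [n.AtLeastTwo] : (ofNat(n) : ZCbrt).b = 0 := rfl
/-- Components of a numeral. [folklore] -/
@[simp] theorem ofNat_c (n : ℕ) [n.AtLeastTwo] : (ofNat(n) : ZCbrt).c = 0 := rfl

/-- An integer `n` is `⟨n, 0, 0⟩`. [folklore] -/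
theorem intCast_def (n : ℤ) : (n : ZCbrt) = ⟨n, 0, 0⟩ := rfl

/-! ### Norm and cofactor -/

/-- The norm `N(a + bθ + cθ²) = a³ + 2b³ + 4c³ - 6abc` (product of the three conjugates).
[folklore] -/
def norm (x : ZCbrt) : ℤ := x.a ^ 3 + 2 * x.b ^ 3 + 4 * x.c ^ 3 - 6 * x.a * x.b * x.c

/-- The cofactor (product of the two non-trivial conjugates): `x * adj x = N(x)`. [folklore] -/
def adj (x : ZCbrt) : ZCbrt :=
  ⟨x.a ^ 2 - 2 * x.b * x.c, 2 * x.c ^ 2 - x.a * x.b, x.b ^ 2 - x.a * x.c⟩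

/-- `N(xy) = N(x) N(y)`. [folklore] -/
theorem norm_mul (x y : ZCbrt) : norm (x * y) = norm x * norm y := by
  simp only [norm, mul_a', mul_b', mul_c']
  ring

/-- `N(1) = 1`. [folklore] -/
@[simp] theorem norm_one : norm 1 = 1 := by simp [norm]

/-- `N(-x) = -N(x)`. [folklore] -/
theorem norm_neg (x : ZCbrt) : norm (-x) = -norm x := by
  simp only [norm, neg_a', neg_b', neg_c']
  ring

/-- `N(x ^ n) = N(x) ^ n`. [folklore] -/
theorem norm_pow (x : ZCbrt) (n : ℕ) : norm (x ^ n) = norm x ^ n := by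
  induction n with
  | zero => simp
  | succ n ih => rw [pow_succ, norm_mul, ih, pow_succ]

/-- `x * adj x = N(x)`. [folklore] -/
theorem mul_adj (x : ZCbrt) : x * adj x = (norm x : ZCbrt) := by
  rw [intCast_def]
  ext <;> simp [adj, norm] <;> ring

/-! ### The real embedding -/

/-- The real cube root of `2`. [folklore] -/
noncomputable def θ : ℝ := (2 : ℝ) ^ ((3 : ℝ)⁻¹)

/-- `θ³ = 2`. [folklore] -/
theorem θ_pow_three : θ ^ 3 = 2 := by
  rw [θ, ← Real.rpow_natCast, ← Real.rpow_mul (by norm_num)]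
  norm_num

/-- `θ > 0`. [folklore] -/
theorem θ_pos : 0 < θ := Real.rpow_pos_of_pos (by norm_num) _

/-- `1.25 < θ` (as `1.25³ = 1.953125 < 2`). [folklore] -/
theorem θ_gt : (5 / 4 : ℝ) < θ := by
  by_contra h
  push Not at h
  have h3 : θ ^ 3 ≤ (5 / 4 : ℝ) ^ 3 := pow_le_pow_left₀ θ_pos.le h 3
  rw [θ_pow_three] at h3
  norm_num at h3

/-- `θ < 1.26` (as `1.26³ = 2.000376 > 2`). [folklore] -/
theorem θ_lt : θ < (63 / 50 : ℝ) := by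
  by_contra h
  push Not at h
  have h3 : (63 / 50 : ℝ) ^ 3 ≤ θ ^ 3 := pow_le_pow_left₀ (by norm_num) h 3
  rw [θ_pow_three] at h3
  norm_num at h3

/-- The real embedding `a + bθ + cθ² ↦ a + b · 2^{1/3} + c · 4^{1/3}`. [folklore] -/
noncomputable def toReal (x : ZCbrt) : ℝ := x.a + x.b * θ + x.c * θ ^ 2

/-- Unfolding the real embedding. [folklore] -/
@[simp] theorem toReal_mk (a b c : ℤ) : toReal ⟨a, b, c⟩ = a + b * θ + c * θ ^ 2 := rfl

/-- The real embedding is multiplicative (this is where `θ³ = 2` enters). [folklore] -/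
theorem toReal_mul (x y : ZCbrt) : toReal (x * y) = toReal x * toReal y := by
  simp only [toReal, mul_a', mul_b', mul_c']
  push_cast
  have h := θ_pow_three
  linear_combination (-(x.b * y.c : ℝ) - x.c * y.b - x.c * y.c * θ) * h

/-- The real embedding is additive. [folklore] -/
theorem toReal_add (x y : ZCbrt) : toReal (x + y) = toReal x + toReal y := by
  simp only [toReal, add_a', add_b', add_c']
  push_cast
  ring

/-- The real embedding of `1`. [folklore] -/
@[simp] theorem toReal_one : toReal 1 = 1 := by simp [toReal]

/-- The real embedding of `0`. [folklore] -/
@[simp] theorem toReal_zero : toReal 0 = 0 := by simp [toReal]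

/-- The real embedding as a ring homomorphism. [folklore] -/
noncomputable def toRealHom : ZCbrt →+* ℝ where
  toFun := toReal
  map_one' := toReal_one
  map_mul' := toReal_mul
  map_zero' := toReal_zero
  map_add' := toReal_add

/-- Unfolding `toRealHom`. [folklore] -/
@[simp] theorem toRealHom_apply (x : ZCbrt) : toRealHom x = toReal x := rfl

/-- The real embedding of `-x`. [folklore] -/
theorem toReal_neg (x : ZCbrt) : toReal (-x) = -toReal x := map_neg toRealHom x

/-- The real embedding of a power. [folklore] -/
theorem toReal_pow (x : ZCbrt) (n : ℕ) : toReal (x ^ n) = toReal x ^ n := map_pow toRealHom x n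

/-- The key identity behind [Schoof2009, Exercise 4.4 (a)]: for `x = a + bθ + cθ²` with real
embedding `x'`, `3 (a² + b²θ² + 2c²θ) · x' = x'³ + 2 N(x)` (both sides equal `x' (x'² + 2|x''|²)`,
`x''` a complex embedding). [cite: Schoof2009, Exercise 4.4] -/
theorem length_identity (x : ZCbrt) :
    3 * ((x.a : ℝ) ^ 2 + x.b ^ 2 * θ ^ 2 + 2 * x.c ^ 2 * θ) * toReal x =
      toReal x ^ 3 + 2 * norm x := by
  simp only [toReal, norm]
  push_cast
  have h := θ_pow_three
  linear_combination (4 * (x.c : ℝ) ^ 3 - (x.c : ℝ) ^ 3 * θ ^ 3 - 3 * (x.b : ℝ) * x.c ^ 2 * θ ^ 2 +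
    2 * (x.b : ℝ) ^ 3 - 3 * (x.a : ℝ) * x.c ^ 2 * θ - 6 * (x.a : ℝ) * x.b * x.c) * h

/-! ### The units `η = ∛2 - 1`, `η⁻¹ = 1 + ∛2 + ∛4` -/

/-- The unit `η = θ - 1` of `ℤ[∛2]` [Schoof2009, Proposition 4.1].
[cite: Schoof2009, Proposition 4.1] -/
def eta : ZCbrt := ⟨-1, 1, 0⟩

/-- Its inverse `η⁻¹ = 1 + θ + θ²` [Schoof2009, proof of Proposition 4.1].
[cite: Schoof2009, Proposition 4.1] -/
def etaInv : ZCbrt := ⟨1, 1, 1⟩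

/-- `η · η⁻¹ = 1`. [cite: Schoof2009, Proposition 4.1] -/
theorem eta_mul_etaInv : eta * etaInv = 1 := by decide

/-- `η⁻¹ · η = 1`. [cite: Schoof2009, Proposition 4.1] -/
theorem etaInv_mul_eta : etaInv * eta = 1 := by decide

/-- `ηⁿ · (η⁻¹)ⁿ = 1`. [folklore] -/
theorem eta_pow_mul_etaInv_pow (n : ℕ) : eta ^ n * etaInv ^ n = 1 := by
  rw [← mul_pow, eta_mul_etaInv, one_pow]

/-- `N(η) = 1`. [folklore] -/
theorem norm_eta : norm eta = 1 := by decide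

/-- `N(η⁻¹) = 1`. [folklore] -/
theorem norm_etaInv : norm etaInv = 1 := by decide

/-- `η' = θ - 1`. [folklore] -/
theorem toReal_eta : toReal eta = θ - 1 := by
  simp [eta, toReal]
  ring

/-- `(η⁻¹)' = 1 + θ + θ²`. [folklore] -/
theorem toReal_etaInv : toReal etaInv = 1 + θ + θ ^ 2 := by
  simp [etaInv, toReal]

/-- `η' · (η⁻¹)' = 1`. [folklore] -/
theorem toReal_eta_mul_toReal_etaInv : toReal eta * toReal etaInv = 1 := by
  rw [← toReal_mul, eta_mul_etaInv, toReal_one]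

/-- The inverse of a norm-`±1` element: `x · (N(x) adj x) = 1`. [folklore] -/
theorem mul_norm_mul_adj {x : ZCbrt} (hN : norm x = 1 ∨ norm x = -1) :
    x * ((norm x : ZCbrt) * adj x) = 1 := by
  rw [mul_left_comm, mul_adj, ← Int.cast_mul]
  rcases hN with h | h <;> simp [h]

/-- The real embedding of a norm-`±1` element is non-zero. [folklore] -/
theorem toReal_ne_zero {x : ZCbrt} (hN : norm x = 1 ∨ norm x = -1) : toReal x ≠ 0 := by
  intro h0
  have h := congrArg toReal (mul_norm_mul_adj hN)
  rw [toReal_mul, h0, zero_mul, toReal_one] at h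
  exact zero_ne_one h

/-- `N(N(x) adj x) = ±1` for a norm-`±1` element. [folklore] -/
theorem norm_norm_mul_adj {x : ZCbrt} (hN : norm x = 1 ∨ norm x = -1) :
    norm ((norm x : ZCbrt) * adj x) = 1 ∨ norm ((norm x : ZCbrt) * adj x) = -1 := by
  have h := congrArg norm (mul_norm_mul_adj hN)
  rw [norm_mul, norm_one] at h
  rcases Int.eq_one_or_neg_one_of_mul_eq_one' h with ⟨-, h2⟩ | ⟨-, h2⟩
  · exact Or.inl h2
  · exact Or.inr h2

/-! ### [Schoof2009, Exercise 4.4]: the units of `ℤ[∛2]` are `± ηⁿ` -/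

/-- **[Schoof2009, Exercise 4.4 (c)]**: an element of `ℤ[∛2]` of norm `±1` whose real embedding
lies in `(1/2, 1]` equals `1`. From `3 (a² + b²θ² + 2c²θ) x' = x'³ + 2 N(x) ≤ 3` one gets
`a² + b²θ² + 2c²θ < 2`, whence `c = 0`, `|a|, |b| ≤ 1`, not both non-zero; the norm and the sign
of `x'` then force `x = 1`. [cite: Schoof2009, Exercise 4.4] -/
theorem eq_one_of_norm_of_toReal {x : ZCbrt} (hN : norm x = 1 ∨ norm x = -1)
    (h1 : 1 / 2 < toReal x) (h2 : toReal x ≤ 1) : x = 1 := by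
  obtain ⟨a, b, c⟩ := x
  have hid := length_identity ⟨a, b, c⟩
  simp only [toReal_mk] at hid h1 h2
  have hθ1 := θ_gt
  have hθ2 := θ_lt
  have hN' : (norm ⟨a, b, c⟩ : ℝ) ≤ 1 := by
    rcases hN with h | h <;> simp [h]
  set t := (a : ℝ) + b * θ + c * θ ^ 2 with ht
  have ht3 : t ^ 3 ≤ 1 := pow_le_one₀ (by linarith) h2
  -- `Q t ≤ 1` and `Q < 2`
  have hQt : ((a : ℝ) ^ 2 + b ^ 2 * θ ^ 2 + 2 * c ^ 2 * θ) * t ≤ 1 := by nlinarith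
  have hQ0 : 0 ≤ (a : ℝ) ^ 2 + b ^ 2 * θ ^ 2 + 2 * c ^ 2 * θ := by positivity
  have hQ : (a : ℝ) ^ 2 + b ^ 2 * θ ^ 2 + 2 * c ^ 2 * θ < 2 := by nlinarith
  -- `c = 0`
  have hc : c = 0 := by
    by_contra hc
    have h1c : (1 : ℝ) ≤ (c : ℝ) ^ 2 := by
      have : 1 ≤ c ^ 2 := by nlinarith [Int.one_le_abs hc, sq_abs c]
      exact_mod_cast this
    nlinarith [sq_nonneg (a : ℝ), sq_nonneg ((b : ℝ) * θ)]
  subst hc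
  -- `|a| ≤ 1`, `|b| ≤ 1`, not both non-zero
  have ha1 : a ^ 2 ≤ 1 := by
    have : (a : ℝ) ^ 2 < 2 := by nlinarith [sq_nonneg ((b : ℝ) * θ)]
    have : a ^ 2 < 2 := by exact_mod_cast this
    omega
  have hb1 : b ^ 2 ≤ 1 := by
    have : (b : ℝ) ^ 2 < 2 := by nlinarith [sq_nonneg (a : ℝ), sq_nonneg (b : ℝ)]
    have : b ^ 2 < 2 := by exact_mod_cast this
    omega
  have hab : a = 0 ∨ b = 0 := by
    by_contra hab
    push Not at hab
    have ha : (1 : ℝ) ≤ (a : ℝ) ^ 2 := by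
      have : 1 ≤ a ^ 2 := by nlinarith [Int.one_le_abs hab.1, sq_abs a]
      exact_mod_cast this
    have hb : (1 : ℝ) ≤ (b : ℝ) ^ 2 := by
      have : 1 ≤ b ^ 2 := by nlinarith [Int.one_le_abs hab.2, sq_abs b]
      exact_mod_cast this
    nlinarith
  have ha' : -1 ≤ a ∧ a ≤ 1 := by constructor <;> nlinarith
  have hb' : -1 ≤ b ∧ b ≤ 1 := by constructor <;> nlinarith
  obtain ⟨ha2, ha3⟩ := ha'
  obtain ⟨hb2, hb3⟩ := hb'
  rcases hab with rfl | rfl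
  · exfalso
    interval_cases b <;> simp [norm] at hN
  · interval_cases a
    · exfalso
      norm_num [ht] at h1
    · simp [norm] at hN
    · rfl

/-- [Schoof2009, Exercise 4.4 (b), (c)], positive embedding: an element of norm `±1` with
`x' > 0` is `ηⁿ` or `(η⁻¹)ⁿ` for some `n : ℕ`. [cite: Schoof2009, Exercise 4.4] -/
theorem exists_eq_pow_of_norm_of_toReal_pos {x : ZCbrt} (hN : norm x = 1 ∨ norm x = -1)
    (hpos : 0 < toReal x) : ∃ n : ℕ, x = eta ^ n ∨ x = etaInv ^ n := by
  have hθ1 := θ_gt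
  have hθ2 := θ_lt
  have hlam : toReal eta = θ - 1 := toReal_eta
  have hmu : toReal etaInv = 1 + θ + θ ^ 2 := toReal_etaInv
  have hlm : toReal eta * toReal etaInv = 1 := toReal_eta_mul_toReal_etaInv
  have hmu1 : 1 < toReal etaInv := by rw [hmu]; nlinarith
  -- Case A: `x' ≤ 1`
  have caseA : ∀ z : ZCbrt, (norm z = 1 ∨ norm z = -1) → 0 < toReal z → toReal z ≤ 1 →
      ∃ n : ℕ, z = eta ^ n := by
    intro z hNz hz0 hz1
    obtain ⟨n, hn1, hn2⟩ := exists_nat_pow_near (show 1 ≤ (toReal z)⁻¹ from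
      (one_le_inv₀ hz0).2 hz1) hmu1
    -- `z' = z (η⁻¹)ⁿ` has embedding in `(θ - 1, 1]`
    set z' := z * etaInv ^ n with hz'
    have hz't : toReal z' = toReal z * toReal etaInv ^ n := by
      rw [hz', toReal_mul, toReal_pow]
    have hNz' : norm z' = 1 ∨ norm z' = -1 := by
      rw [hz', norm_mul, norm_pow, norm_etaInv, one_pow, mul_one]; exact hNz
    have hup : toReal z' ≤ 1 := by
      rw [hz't]
      have := mul_le_mul_of_nonneg_left hn1 hz0.le
      rwa [mul_inv_cancel₀ hz0.ne'] at this
    have hlow : θ - 1 < toReal z' := by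
      rw [hz't]
      have h3 : (toReal z)⁻¹ * toReal eta < toReal etaInv ^ n := by
        have := mul_lt_mul_of_pos_right hn2 (show 0 < toReal eta by rw [hlam]; linarith)
        rwa [pow_succ, mul_assoc, mul_comm (toReal etaInv) (toReal eta), hlm, mul_one] at this
      have := mul_lt_mul_of_pos_left h3 hz0
      rwa [← mul_assoc, mul_inv_cancel₀ hz0.ne', one_mul, hlam] at this
    by_cases hhalf : 1 / 2 < toReal z'
    · -- `z' = 1`, so `z = ηⁿ`
      have h1 : z' = 1 := eq_one_of_norm_of_toReal hNz' hhalf hup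
      refine ⟨n, ?_⟩
      calc z = z * (etaInv ^ n * eta ^ n) := by
              rw [mul_comm (etaInv ^ n), eta_pow_mul_etaInv_pow, mul_one]
        _ = z' * eta ^ n := by rw [← mul_assoc]
        _ = eta ^ n := by rw [h1, one_mul]
    · -- `(z')⁻¹ η` has embedding in `[2(θ-1), 1)`, so it is `1` and `z' = η`
      push Not at hhalf
      set w := (norm z' : ZCbrt) * adj z' with hw
      have hzw : z' * w = 1 := mul_norm_mul_adj hNz'
      have hwt : toReal w = (toReal z')⁻¹ := by
        have h := congrArg toReal hzw
        rw [toReal_mul, toReal_one] at h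
        exact (eq_inv_of_mul_eq_one_right h)
      have hz'0 : 0 < toReal z' := by linarith
      have hNw : norm (w * eta) = 1 ∨ norm (w * eta) = -1 := by
        rw [norm_mul, norm_eta, mul_one]; exact norm_norm_mul_adj hNz'
      have hwe1 : 1 / 2 < toReal (w * eta) := by
        rw [toReal_mul, hwt, hlam]
        rw [div_lt_iff₀ (by norm_num : (0:ℝ) < 2)] at *
        have : 2 * (θ - 1) * 1 ≤ 2 * (θ - 1) * ((toReal z')⁻¹ * (toReal z') ) := by
          rw [inv_mul_cancel₀ hz'0.ne']
        have h2 : (1 : ℝ) ≤ (toReal z')⁻¹ * (1 / 2) * 2 := by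
          rw [mul_assoc, show (1 / 2 : ℝ) * 2 = 1 by norm_num, mul_one]
          exact (one_le_inv₀ hz'0).2 (by linarith)
        nlinarith [(one_le_inv₀ hz'0).2 (by linarith : toReal z' ≤ 1)]
      have hwe2 : toReal (w * eta) ≤ 1 := by
        rw [toReal_mul, hwt, hlam]
        rw [inv_mul_le_iff₀ hz'0]
        linarith
      have h1 : w * eta = 1 := eq_one_of_norm_of_toReal hNw hwe1 hwe2
      have hz'e : z' = eta := by
        calc z' = z' * (w * eta) := by rw [h1, mul_one]
          _ = eta := by rw [← mul_assoc, hzw, one_mul]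
      refine ⟨n + 1, ?_⟩
      calc z = z * (etaInv ^ n * eta ^ n) := by
              rw [mul_comm (etaInv ^ n), eta_pow_mul_etaInv_pow, mul_one]
        _ = z' * eta ^ n := by rw [← mul_assoc]
        _ = eta ^ (n + 1) := by rw [hz'e, pow_succ']
  by_cases hx1 : toReal x ≤ 1
  · obtain ⟨n, hn⟩ := caseA x hN hpos hx1
    exact ⟨n, Or.inl hn⟩
  · -- Case B: `x' > 1`, apply Case A to the inverse
    push Not at hx1
    set w := (norm x : ZCbrt) * adj x with hw
    have hxw : x * w = 1 := mul_norm_mul_adj hN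
    have hwt : toReal w = (toReal x)⁻¹ := by
      have h := congrArg toReal hxw
      rw [toReal_mul, toReal_one] at h
      exact eq_inv_of_mul_eq_one_right h
    have hw0 : 0 < toReal w := by rw [hwt]; positivity
    have hw1 : toReal w ≤ 1 := by rw [hwt]; exact inv_le_one_of_one_le₀ hx1.le
    obtain ⟨n, hn⟩ := caseA w (norm_norm_mul_adj hN) hw0 hw1
    refine ⟨n, Or.inr ?_⟩
    calc x = x * (eta ^ n * etaInv ^ n) := by rw [eta_pow_mul_etaInv_pow, mul_one]
      _ = x * w * etaInv ^ n := by rw [hn, mul_assoc]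
      _ = etaInv ^ n := by rw [hxw, one_mul]

/-- **[Schoof2009, Exercise 4.4] — the units of `ℤ[∛2]`**: every element of norm `±1` is
`± ηⁿ` or `± (η⁻¹)ⁿ` for some `n : ℕ`, i.e. the unit group is `{±1} × η^ℤ` with
`η = ∛2 - 1`. [cite: Schoof2009, Exercise 4.4] -/
theorem exists_eq_eta_pow_of_norm {x : ZCbrt} (hN : norm x = 1 ∨ norm x = -1) :
    ∃ n : ℕ, x = eta ^ n ∨ x = etaInv ^ n ∨ x = -eta ^ n ∨ x = -etaInv ^ n := by
  rcases lt_or_gt_of_ne (toReal_ne_zero hN) with hneg | hpos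
  · have hN' : norm (-x) = 1 ∨ norm (-x) = -1 := by
      rw [norm_neg]; rcases hN with h | h <;> simp [h]
    have hpos' : 0 < toReal (-x) := by rw [toReal_neg]; linarith
    obtain ⟨n, hn | hn⟩ := exists_eq_pow_of_norm_of_toReal_pos hN' hpos'
    · exact ⟨n, Or.inr (Or.inr (Or.inl (by rw [← hn, neg_neg])))⟩
    · exact ⟨n, Or.inr (Or.inr (Or.inr (by rw [← hn, neg_neg])))⟩
  · obtain ⟨n, hn | hn⟩ := exists_eq_pow_of_norm_of_toReal_pos hN hpos
    · exact ⟨n, Or.inl hn⟩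
    · exact ⟨n, Or.inr (Or.inl hn)⟩

end ZCbrt

end Literature.NumberTheory.DiophantineGeometry
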